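import Literature.AlgebraicGeometry.AbelianVarieties.PoincareSheafNormalised
import Literature.AlgebraicGeometry.AbelianVarieties.HomogeneousLineBundleDivisor
import HarnessLib

/-!
# Slices of the Poincaré sheaf of `(A, Θ)` over `ℂ`: `𝒫|_{A × {φ_Θ(a)}} ≅ t_a^*𝒪(Θ) ⊗ 𝒪(Θ)⁻¹` and `𝒫|_{A × {b}} ∈ Pic⁰(A)`

Layer `Literature/AlgebraicGeometry/AbelianVarieties`, namespace `Literature.AlgebraicGeometry.AbelianVarieties`. THEOREMS
ONLY; no named fact, no instance, no notation. Cell `hodgecm-mathlib` (D-0151), M1PRIME-DAG rung 0, J0a junction, leaf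
(J0a-3c) (B-p07 lineage). For a complex abelian variety `A`, an ample `Θ`, and ANY quasi-coherent line bundle `𝒫` on
`A × Â` (`Â = A/K(Θ)`) with `(1 × φ_Θ)^*𝒫 ≅ Λ(𝒪(Θ))` (e.g. ★ `exists_poincareSheaf_normalised`):

* `sliceAt_comp_oneProdPhiTheta` — the slice square `(𝟙, a) ≫ (1 × φ_Θ) = (𝟙, φ_Θ a)`;
* **`detClass_pullback_sliceAt_map_phiTheta`** — `[𝒫|_{A × {φ_Θ a}}] = [t_a^*𝒪(Θ)]·[𝒪(Θ)]⁻¹` in `Ȟ¹(A, 𝒪^×)`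
  ([MumfordAV1970] §8: «`P|_{X × {φ_L(a)}} ≅ T_a^*L ⊗ L⁻¹`»; the (R2-slice) input of the J0b road (i));
* `pullback_translation_detClass_pullback_sliceAt` — `t_x^*[𝒫|_{A×{b}}] = [𝒫|_{A×{b}}]` (theorem of the square);
* **`isHomogeneous_pullback_sliceAt`** — `𝒫|_{A × {b}} ∈ Pic⁰(A)` for EVERY complex point `b` of `Â` (`φ_Θ` is onto on
  `ℂ`-points) — the field `fibrewisePicZero` of the tree's `AbelianSchemes.DualPair` at `Ω = ℂ`
  ([MilneAV2008] I §8 (a); the all-`Ω` form of the typed field is the recorded caveat P43).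
Banked capital; HC_CM is proved only modulo the 7 printed citations until rung 0 closes.

## References

* [MumfordAV1970] D. Mumford, *Abelian Varieties* (1970), §8 pp. 78–80 (slices of `P`), §6 Cor. 4 (theorem of the square).
* [MilneAV2008] J. S. Milne, *Abelian Varieties* (2008), I §8 (pp. 36–40).
-/

noncomputable section

open CategoryTheory AlgebraicGeometry MonoidalCategory CartesianMonoidalCategory Opposite
open Literature.AlgebraicGeometry.Motives Literature.AlgebraicGeometry.Modules
open scoped MonObj

universe u

namespace Literature.AlgebraicGeometry.AbelianVarieties

variable (A : AbelianVariety ℂ) {Θ : CartierDivisor A.X.left} (hΘ : Θ.IsAmple)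

/-- `(f ≫ g)^* = f^* ∘ g^*` on `Ȟ¹(–, 𝒪^×)` (the tree's `CechPic.pullback_comp`, `Modules/UnitCocyclePresented`, re-proved
privately to keep the import cone small, as in ★ `PoincareSheafOfPrincipal`). [cite: Hartshorne1977, II Ex. 6.8 (functoriality of f^* on Pic)] -/
private theorem cechPic_pullback_comp {X Y Z : Scheme.{u}} (f : X ⟶ Y) (g : Y ⟶ Z) (c : CechPic Z) :
    CechPic.pullback (f ≫ g) c = CechPic.pullback f (CechPic.pullback g c) := by
  obtain ⟨c, rfl⟩ := CechPic.mk_surjective c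
  rw [CechPic.pullback_mk, CechPic.pullback_mk, CechPic.pullback_mk]
  refine CechPic.sound (UnitCocycle.equiv_of_eq _ _
    (fun x => f ⁻¹ᵁ (g ⁻¹ᵁ c.U (g.base (f.base x)))) (fun x => c.mem (g.base (f.base x)))
    (fun x => le_of_eq rfl) (fun x => le_rfl) fun x y V hx hy => ?_)
  change (g.appLE _ _ _ ≫ f.appLE _ V _) (c.g _ _ _ _ _) = (f ≫ g).appLE _ V _ (c.g _ _ _ _ _)
  rw [Scheme.Hom.appLE_comp_appLE]
  rfl


/-- **The slice square `(𝟙, a) ≫ (1 × φ_Θ) = (𝟙, φ_Θ(a))`** on underlying schemes: the slice `A × {a} ⊂ A × A` maps by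
`1 × φ_Θ` onto the slice `A × {φ_Θ a} ⊂ A × Â`. [cite: MumfordAV1970, §8 (pp. 78–80)] -/
theorem sliceAt_comp_oneProdPhiTheta (a : A.Points ℂ) :
    (lift (𝟙 A.X) (toSpecOver A.X ≫ a)).left ≫ AbelianVariety.Hom.toSchemeHom (A.oneProdPhiTheta hΘ) =
      (lift (𝟙 A.X) (toSpecOver A.X ≫ AlgPoints.map (A.phiTheta Θ hΘ).hom.hom.hom a)).left := by
  obtain ⟨F, hF⟩ : ∃ F : A.X ⊗ A.X ⟶ A.X ⊗ (A.dualOf Θ hΘ).X, F = (A.oneProdPhiTheta hΘ).hom.hom.hom := ⟨_, rfl⟩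
  obtain ⟨φ, hφ⟩ : ∃ φ : A.X ⟶ (A.dualOf Θ hΘ).X, φ = (A.phiTheta Θ hΘ).hom.hom.hom := ⟨_, rfl⟩
  have h1 : F ≫ fst A.X (A.dualOf Θ hΘ).X = fst A.X A.X := by
    rw [hF]; exact AbelianVariety.oneProdPhiTheta_comp_fst A hΘ
  have h2 : F ≫ snd A.X (A.dualOf Θ hΘ).X = snd A.X A.X ≫ φ := by
    rw [hF, hφ]; exact AbelianVariety.oneProdPhiTheta_comp_snd A hΘ
  have hsq : lift (𝟙 A.X) (toSpecOver A.X ≫ a) ≫ F = lift (𝟙 A.X) (toSpecOver A.X ≫ (a ≫ φ)) := by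
    refine CartesianMonoidalCategory.hom_ext _ _ ?_ ?_
    · rw [Category.assoc, h1, lift_fst, lift_fst]
    · rw [Category.assoc, h2, lift_snd_assoc, lift_snd, Category.assoc]
  have e1 : AbelianVariety.Hom.toSchemeHom (A.oneProdPhiTheta hΘ) = F.left := by rw [hF]
  rw [e1, AlgPoints.map_apply, ← hφ]
  exact congrArg CommaMorphism.left hsq

variable {P : (A.prod (A.dualOf Θ hΘ)).X.left.Modules} (hP1 : HasRank P 1)
  (eP : Nonempty ((Scheme.Modules.pullback (AbelianVariety.Hom.toSchemeHom (A.oneProdPhiTheta hΘ))).obj P ≅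
    mumfordSheaf A Θ))

include eP in
/-- **`[𝒫|_{A × {φ_Θ(a)}}] = [t_a^*𝒪(Θ)]·[𝒪(Θ)]⁻¹`** in `Ȟ¹(A, 𝒪_A^×)`, for any line bundle `𝒫` on `A × Â` with
`(1 × φ_Θ)^*𝒫 ≅ Λ(𝒪(Θ))` (the slice square + ★ `pullback_mk_mumfordCocycle_of_snd_eq_const`).
[cite: MumfordAV1970, §8 (pp. 78–80)] -/
theorem detClass_pullback_sliceAt_map_phiTheta (a : A.Points ℂ) :
    detClass ((HasRank.isFiniteLocallyFree' hP1).pullback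
        (lift (𝟙 A.X) (toSpecOver A.X ≫ AlgPoints.map (A.phiTheta Θ hΘ).hom.hom.hom a)).left) =
      (Θ.pullback (A.translation a).left).cechClass * Θ.cechClass⁻¹ := by
  obtain ⟨e⟩ := eP
  have hF : IsFiniteLocallyFree P := HasRank.isFiniteLocallyFree' hP1
  -- `[(1 × φ_Θ)^*𝒫] = [Λ(Θ)]`
  have h3 : CechPic.pullback (AbelianVariety.Hom.toSchemeHom (A.oneProdPhiTheta hΘ)) (detClass hF) =
      CechPic.mk (mumfordCocycle A Θ) :=
    ((detClass_pullback _ hF).symm.trans (detClass_eq_of_iso e (hF.pullback _)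
      (isFiniteLocallyFree_mumfordSheaf A Θ))).trans (mumfordCocycle A Θ).detClass_lineBundle
  -- `[Λ|_{A × {a}}] = [t_a^*Θ]·[Θ]⁻¹`
  have h := pullback_mk_mumfordCocycle_of_snd_eq_const A Θ (lift (𝟙 A.X) (toSpecOver A.X ≫ a)) a (lift_snd _ _)
  rw [lift_fst, Over.id_left, CechPic.pullback_id_apply] at h
  rw [detClass_pullback _ hF, ← sliceAt_comp_oneProdPhiTheta A hΘ a, cechPic_pullback_comp]
  exact (congrArg (CechPic.pullback (lift (𝟙 A.X) (toSpecOver A.X ≫ a)).left) h3).trans h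

include eP in
/-- **`t_x^*[𝒫|_{A × {φ_Θ(a)}}] = [𝒫|_{A × {φ_Θ(a)}}]` for every complex point `x`** — by the theorem of the square
(★ `theoremOfTheSquare_holds`: `t_{ax}^*Θ + Θ ∼ t_a^*Θ + t_x^*Θ`). [cite: MumfordAV1970, §6 Cor. 4 and §8 (definition of Pic⁰)] -/
theorem pullback_translation_detClass_pullback_sliceAt (a x : A.Points ℂ) :
    CechPic.pullback (A.translation x).left
        (detClass ((HasRank.isFiniteLocallyFree' hP1).pullback
          (lift (𝟙 A.X) (toSpecOver A.X ≫ AlgPoints.map (A.phiTheta Θ hΘ).hom.hom.hom a)).left)) =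
      detClass ((HasRank.isFiniteLocallyFree' hP1).pullback
        (lift (𝟙 A.X) (toSpecOver A.X ≫ AlgPoints.map (A.phiTheta Θ hΘ).hom.hom.hom a)).left) := by
  have hsq := ((A.theoremOfTheSquare_holds a x Θ).cechClass_eq)
  rw [CartierDivisor.cechClass_add, CartierDivisor.cechClass_add, CartierDivisor.cechClass_pullback,
    CartierDivisor.cechClass_pullback, CartierDivisor.cechClass_pullback] at hsq
  have ht : (A.translation x).left ≫ (A.translation a).left = (A.translation (a * x)).left := by
    rw [← Over.comp_left, AbelianVariety.translation_comp]
  rw [detClass_pullback_sliceAt_map_phiTheta A hΘ hP1 eP, MonoidHom.map_mul, MonoidHom.map_inv,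
    CartierDivisor.cechClass_pullback, ← cechPic_pullback_comp, CechPic.pullback_congr_hom ht,
    mul_inv_eq_iff_eq_mul, mul_right_comm, ← hsq, mul_assoc, mul_inv_cancel, mul_one]

include hP1 eP in
/-- **`𝒫|_{A × {b}} ∈ Pic⁰(A)` for every complex point `b` of `Â`**: the slice is translation invariant
(`IsHomogeneous`), since every `b` is `φ_Θ(a)` (★ `AbelianVariety.surjective_map_phiTheta`) and `[𝒫|_{A×{φ_Θ a}}] =
[t_a^*Θ − Θ]` is fixed by all translations (theorem of the square). This is the `fibrewisePicZero` clause of a dual pair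
for `dualOf A Θ` at the complex points. [cite: MilneAV2008, I §8 (p. 37 (a))] [cite: MumfordAV1970, §8 (definition of Pic⁰)] -/
theorem isHomogeneous_pullback_sliceAt (b : (A.dualOf Θ hΘ).Points ℂ) :
    IsHomogeneous A ((Scheme.Modules.pullback (lift (𝟙 A.X) (toSpecOver A.X ≫ b)).left).obj P) := by
  obtain ⟨a, rfl⟩ := A.surjective_map_phiTheta hΘ b
  exact (isHomogeneous_iff_forall_pullback_detClass_eq A (hasRank_pullback _ hP1)
    ((HasRank.isFiniteLocallyFree' hP1).pullback _)).2
    (pullback_translation_detClass_pullback_sliceAt A hΘ hP1 eP a)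

end Literature.AlgebraicGeometry.AbelianVarieties

end
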